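import Mathlib.Topology.Homotopy.Lifting
import Literature.LinearAlgebra.QuadraticForm.PosComplexStructuresArithmeticQuotient
import Literature.LinearAlgebra.QuadraticForm.PosComplexStructuresContractible
import HarnessLib

/-!
# `π₁(Γ\X⁺) ≅ Γ`: the arithmetic quotient of the period domain has fundamental group `Γ`

Topic `LinearAlgebra/QuadraticForm`; assembly of `QuadraticForm/PosComplexStructuresArithmeticQuotient`
(for a subgroup `Γ` of Deligne's arithmetic group `Aut(V(ℤ), ψ, k)` without non-trivial elements
of finite order, `X⁺ → Γ\X⁺` is a quotient covering map onto a Hausdorff space) and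
`QuadraticForm/PosComplexStructuresContractible` (`X⁺` is contractible, in particular simply
connected) with Mathlib's covering-space theory
(`IsQuotientCoveringMap.fundamentalGroupEquiv`: the fundamental group of the base of a simply
connected quotient covering is the group, contravariantly, via the monodromy on the fibre).
Setting of [Deligne1982HodgeCycles, proof of Thm. 4.8, pp. 48–50]: `X⁺` the domain of `k`-linear
`ψ`-positive complex structures, `Γ` a torsion-free congruence subgroup, `S = Γ\X⁺` the base of
the algebraic family `Γ\B → Γ\X⁺`; the conclusion `π₁(S, s₀) ≅ Γ` (with the monodromy of the
universal cover `X⁺ → S` being the deck action of `Γ`) is the topological input of "the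
monodromy of `R¹ f_* ℤ` on `S` is the inclusion `Γ ⊂ GL(V(ℤ))`, in particular lands in
`SU(V(ℤ), ψ)`" (p. 50).

* `arithmeticGroup.fundamentalGroupQuotientEquivMulOpposite` — `π₁(Γ\X⁺, [J₀]) ≃* Γᵐᵒᵖ`
  (Mathlib's contravariant form: `γ ↦ g` with `g • J₀ =` the monodromy of `γ` at `J₀`);
* `arithmeticGroup.fundamentalGroupQuotientEquiv` — `π₁(Γ\X⁺, [J₀]) ≃* Γ` (composed with
  `g ↦ g⁻¹`);
* `arithmeticGroup.pathConnectedSpace_quotient` — `Γ\X⁺` is path connected.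

Everything is proved (two short definitions of group isomorphisms, from accepted tree theorems
and Mathlib); no named facts.

## References

* [Deligne1982HodgeCycles] P. Deligne (notes by J. S. Milne), Hodge cycles on abelian varieties,
  LNM 900 (1982), proof of Thm. 4.8, pp. 48–50.
* [HatcherAT2002] A. Hatcher, Algebraic Topology, CUP 2002, Prop. 1.40 (c) (`π₁(X̃/G) ≅ G` for a
  covering space action on a simply connected `X̃`).
-/

noncomputable section

namespace Literature.LinearAlgebra.QuadraticForm

namespace arithmeticGroup

variable {V : Type*} [NormedAddCommGroup V] [NormedSpace ℝ V] [FiniteDimensional ℝ V]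
variable {k : V →L[ℝ] V} {ψ : LinearMap.BilinForm ℝ V} {d : ℝ} {Λ : Submodule ℤ V}
  [DiscreteTopology Λ] [IsZLattice ℝ Λ]

/-- **`π₁(Γ\X⁺, [J₀]) ≃* Γᵐᵒᵖ`.** For `d > 0`, `k² = -d`, `ψ` alternating with
`ψ (k x, y) = -ψ (x, k y)`, a full lattice `Λ`, a subgroup `Γ` of the arithmetic group
`Aut(Λ, ψ, k)` without non-trivial elements of finite order, and a base point `J₀ ∈ X⁺`: the
fundamental group of the orbit space `Γ\X⁺` at `[J₀]` is anti-isomorphic to `Γ`, by the monodromy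
of the universal covering `X⁺ → Γ\X⁺` (`isQuotientCoveringMap_of_torsionFree`; `X⁺` is simply
connected, `simplyConnectedSpace_posComplexStructures`) on the fibre `Γ • J₀`
(Mathlib `IsQuotientCoveringMap.fundamentalGroupEquiv`). [cite: HatcherAT2002, Prop. 1.40 (c)] -/
def fundamentalGroupQuotientEquivMulOpposite (hd : 0 < d) (hk : k * k = -(d • (1 : V →L[ℝ] V)))
    (hψ : ψ.IsAlt) (hψk : ∀ x y, ψ (k x) y = -ψ x (k y)) (G : Subgroup (arithmeticGroup k ψ Λ))
    (htf : ∀ g : G, IsOfFinOrder g → g = 1) (J₀ : posComplexStructures k ψ) :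
    FundamentalGroup (Quotient (MulAction.orbitRel G (posComplexStructures k ψ)))
        (Quotient.mk (MulAction.orbitRel G (posComplexStructures k ψ)) J₀) ≃* Gᵐᵒᵖ :=
  haveI := simplyConnectedSpace_posComplexStructures hd hk hψ hψk ⟨J₀, J₀.2⟩
  (isQuotientCoveringMap_of_torsionFree G htf).fundamentalGroupEquiv ⟨J₀, rfl⟩

/-- **`π₁(Γ\X⁺) ≅ Γ`** ([Deligne1982HodgeCycles, p. 50]: the base `S = Γ\X⁺` of the family has
fundamental group the torsion-free arithmetic group `Γ`, through which the monodromy acts):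
`fundamentalGroupQuotientEquivMulOpposite` composed with the inversion `Γᵐᵒᵖ ≃* Γ`.
[cite: Deligne1982HodgeCycles, proof of Thm. 4.8, p. 50] -/
def fundamentalGroupQuotientEquiv (hd : 0 < d) (hk : k * k = -(d • (1 : V →L[ℝ] V)))
    (hψ : ψ.IsAlt) (hψk : ∀ x y, ψ (k x) y = -ψ x (k y)) (G : Subgroup (arithmeticGroup k ψ Λ))
    (htf : ∀ g : G, IsOfFinOrder g → g = 1) (J₀ : posComplexStructures k ψ) :
    FundamentalGroup (Quotient (MulAction.orbitRel G (posComplexStructures k ψ)))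
        (Quotient.mk (MulAction.orbitRel G (posComplexStructures k ψ)) J₀) ≃* G :=
  (fundamentalGroupQuotientEquivMulOpposite hd hk hψ hψk G htf J₀).trans (MulEquiv.inv' G).symm

/-- In particular `π₁(Γ\X⁺, [J₀])` is isomorphic to `Γ` (existence form). [folklore] -/
theorem nonempty_fundamentalGroup_quotient_mulEquiv (hd : 0 < d)
    (hk : k * k = -(d • (1 : V →L[ℝ] V))) (hψ : ψ.IsAlt) (hψk : ∀ x y, ψ (k x) y = -ψ x (k y))
    (G : Subgroup (arithmeticGroup k ψ Λ)) (htf : ∀ g : G, IsOfFinOrder g → g = 1)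
    (J₀ : posComplexStructures k ψ) :
    Nonempty (FundamentalGroup (Quotient (MulAction.orbitRel G (posComplexStructures k ψ)))
        (Quotient.mk (MulAction.orbitRel G (posComplexStructures k ψ)) J₀) ≃* G) :=
  ⟨fundamentalGroupQuotientEquiv hd hk hψ hψk G htf J₀⟩

omit [FiniteDimensional ℝ V] [DiscreteTopology Λ] [IsZLattice ℝ Λ] in
/-- **`Γ\X⁺` is path connected** (for any subgroup `Γ` of the arithmetic group, when `X⁺` is
non-empty): the orbit space of the contractible, hence path connected, `X⁺`
([Deligne1982HodgeCycles, p. 49]: "`X⁺` … connected", so the base `S = Γ\X⁺` is irreducible).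
[folklore] -/
theorem pathConnectedSpace_quotient [FiniteDimensional ℝ V] (hd : 0 < d)
    (hk : k * k = -(d • (1 : V →L[ℝ] V))) (hψ : ψ.IsAlt) (hψk : ∀ x y, ψ (k x) y = -ψ x (k y))
    (hne : (posComplexStructures k ψ).Nonempty) (G : Subgroup (arithmeticGroup k ψ Λ)) :
    PathConnectedSpace (Quotient (MulAction.orbitRel G (posComplexStructures k ψ))) := by
  haveI := contractibleSpace_posComplexStructures hd hk hψ hψk hne
  infer_instance

end arithmeticGroup

end Literature.LinearAlgebra.QuadraticForm
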